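import Summits.QuantumAdvantage.QuantumAdvantage.Theorems.CubicForrelationNearExactIsExactKtGapOrderTools

/-!
# Crux `CubicForrelation.NearExactIsExact` (stmt-QuantumAdvantage-14043) — the Kasami–Tokura gap `(1.5d, 1.75d)` for EVERY order, II: the
  inductive step (from the gap for order `r + 1` on `k + r + 2` bits and the gap for order `r` to a Diophantine system on `k + r + 3` bits)

Certificate seat `b2b-cforr-cert` (gen 45).  HONEST FRAMING: a coding-theory BRICK (standard axioms), uniform in `k` AND in the order; the
closing arithmetic is `…KtGapOrderClose.lean` and the assembly `…KtGapOrder.lean`.  This is `ktg_step` (gen 16, order 3) with the order as a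
parameter.  NOT summit progress.

`kto_step`.  Let `c` have degree `≤ r + 1` (`r ≥ 2`) on `m = k + r + 3` bits with `6·2^k < w = #E < 7·2^k` (`d = 2^{m-r-1} = 4·2^k`),
`t = w − 6·2^k`; assume the gap for order `r + 1` on `k + r + 2` bits (no weight in `(3·2^k, 3.5·2^k)`) and the gap for order `r` on `m` bits.
(i) `I(a) = #(E ∩ (E⊕a)) ∈ {t, 2·2^k + t, w}` and `2·2^k ∣ w²` (`kto_deriv_values`, `kto_sq_dvd`).  (ii) A period `a ≠ 0` would make `c`
descend to `k + r + 2` bits with weight `w/2` inside the smaller gap.  (iii) For `z ≠ 0` the two halves `#(E ∩ {⟨x,z⟩ = b})` are weights of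
functions of degree `≤ r + 1` on `k + r + 2` bits (`ktg_restrict`), hence in `{0, 2·2^k, 3·2^k} ∪ [3.5·2^k, ∞)` (second weight + the smaller
gap), and they add up to `w`: so `F(z) = Σ_E (−1)^{x·z} ∈ {±t, ±(2·2^k + t)}`.  (iv) Parseval, the fourth moment and `Σ_a I(a) = w²` give the
system in `A, B, n₁, n₂` with `N = 2^m` in place of the order-3 value `32·2^k`.

References: T. Kasami, N. Tokura, IEEE Trans. IT 16 (1970) 752–759; MacWilliams–Sloane (1977) Ch. 15 §3; O'Donnell (2014) §3.3.  Axioms: standard.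
-/

set_option linter.dupNamespace false -- D-0017: single-problem summit ⇒ `QuantumAdvantage.QuantumAdvantage` by design

noncomputable section

namespace Summit.QuantumAdvantage.QuantumAdvantage.Theorems.CubicForrelation.NearExactIsExact

open Finset
open Literature.Computability.QuantumComplexity
open Literature.Computability.QuantumComplexity.BuzetChailloux (bxor zeroVec bxor_bxor_cancel_left bxor_zeroVec zeroVec_bxor bxor_comm
  bxor_self twist_zeroVec_right twist_bxor_right)
open Literature.Computability.QuantumComplexity.DerivativeWalsh (W twist_bxor_left)
open Literature.Computability.QuantumComplexity.Simon (twist_eq_one_or)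

/-! ### The inductive step, every order -/

/-- **Inductive step, order `r + 1` (`r ≥ 2`).**  If no function of degree `≤ r + 1` on `k + r + 2` bits has weight in `(3·2^k, 3.5·2^k)`
and the Kasami–Tokura gap holds for order `r` on `k + r + 3` bits, then a function `c` of degree `≤ r + 1` on `k + r + 3` bits with
`6·2^k < w = #{c = 1} < 7·2^k` yields naturals `t, A, B, n₁, n₂` with `w = 6·2^k + t`, `2·2^k ∣ w²`, `A + B + 1 = n₁ + n₂ + 1 = 2^{k+r+3}`,
`A t² + B (2·2^k + t)² + w² = 2^{k+r+3} w` (Parseval), `n₁ (2·2^k + t) + n₂ t + w = w²` (`Σ I = w²`), and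
`w⁴ + A t⁴ + B (2·2^k + t)⁴ = 2^{k+r+3} (w² + n₁ (2·2^k + t)² + n₂ t²)` (fourth moment). [this work] -/
theorem kto_step (k r : ℕ) (hr : 2 ≤ r)
    (ih : ∀ c' : (Fin (k + r + 2) → Bool) → Bool, IsDegLeFun (r + 1) c' →
      ¬ (3 * 2 ^ k < #(univ.filter fun y => c' y = true) ∧ 2 * #(univ.filter fun y => c' y = true) < 7 * 2 ^ k))
    (hgap : ∀ e : (Fin (k + r + 2 + 1) → Bool) → Bool, IsDegLeFun r e →
      ¬ (3 * 2 ^ (k + r + 2 + 1) < 2 ^ (r + 1) * #(univ.filter fun x => e x = true) ∧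
          2 ^ (r + 2) * #(univ.filter fun x => e x = true) < 7 * 2 ^ (k + r + 2 + 1)))
    (c : (Fin (k + r + 2 + 1) → Bool) → Bool) (hc : IsDegLeFun (r + 1) c)
    (h1 : 6 * 2 ^ k < #(univ.filter fun x => c x = true)) (h2 : #(univ.filter fun x => c x = true) < 7 * 2 ^ k) :
    ∃ w t A B n₁ n₂ : ℕ, w = #(univ.filter fun x => c x = true) ∧ w = 6 * 2 ^ k + t ∧ 2 * 2 ^ k ∣ w * w ∧
      A + B + 1 = 2 ^ (k + r + 2 + 1) ∧ A * t ^ 2 + B * (2 * 2 ^ k + t) ^ 2 + w ^ 2 = 2 ^ (k + r + 2 + 1) * w ∧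
      n₁ + n₂ + 1 = 2 ^ (k + r + 2 + 1) ∧ n₁ * (2 * 2 ^ k + t) + n₂ * t + w = w ^ 2 ∧
      w ^ 4 + A * t ^ 4 + B * (2 * 2 ^ k + t) ^ 4 = 2 ^ (k + r + 2 + 1) * (w ^ 2 + n₁ * (2 * 2 ^ k + t) ^ 2 + n₂ * t ^ 2) := by
  classical
  set S := univ.filter (fun x : Fin (k + r + 2 + 1) → Bool => c x = true) with hSdef
  have hmemS : ∀ x, x ∈ S ↔ c x = true := fun x => by simp [hSdef]
  have hN : (2 : ℕ) ^ (k + r + 2 + 1) = 2 ^ (r + 2) * (2 * 2 ^ k) := by ring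
  have hN3 : 3 * (2 : ℕ) ^ (k + r + 2 + 1) = 2 ^ (r + 2) * (6 * 2 ^ k) := by ring
  have hN1 : (2 : ℕ) ^ (k + r + 2 + 1) = 2 ^ (r + 1) * (4 * 2 ^ k) := by ring
  have hN7 : 7 * (2 : ℕ) ^ (k + r + 2 + 1) = 2 ^ (r + 3) * (7 * 2 ^ k) := by ring
  have hNK : (2 : ℕ) ^ (k + r + 2) = 2 ^ (r + 1) * (2 * 2 ^ k) := by ring
  have hNK3 : 3 * (2 : ℕ) ^ (k + r + 2) = 2 ^ (r + 2) * (3 * 2 ^ k) := by ring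
  have hP1 : 0 < (2 : ℕ) ^ (r + 1) := Nat.two_pow_pos _
  have hP2 : 0 < (2 : ℕ) ^ (r + 2) := Nat.two_pow_pos _
  obtain ⟨t, hwt⟩ : ∃ t, #S = 6 * 2 ^ k + t := ⟨#S - 6 * 2 ^ k, by omega⟩
  have h2' : 2 ^ (r + 3) * #S < 7 * 2 ^ (k + r + 2 + 1) := by rw [hN7]; exact Nat.mul_lt_mul_of_pos_left h2 (Nat.two_pow_pos _)
  /- (1) derivative intersections `I(a) ∈ {t, 2·2^k + t, w}` -/
  have hIval : ∀ a, #(S.filter fun x => bxor x a ∈ S) = t ∨ #(S.filter fun x => bxor x a ∈ S) = 2 * 2 ^ k + t ∨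
      #(S.filter fun x => bxor x a ∈ S) = #S := by
    intro a
    rcases kto_deriv_values hr hgap c hc h2' a with h | h | h
    · left
      change 2 ^ (r + 2) * #(S.filter fun x => bxor x a ∈ S) + 3 * 2 ^ (k + r + 2 + 1) = 2 ^ (r + 2) * #S at h
      rw [hN3, ← mul_add] at h
      have := Nat.eq_of_mul_eq_mul_left hP2 h
      omega
    · right; left
      change 2 ^ (r + 1) * #(S.filter fun x => bxor x a ∈ S) + 2 ^ (k + r + 2 + 1) = 2 ^ (r + 1) * #S at h
      rw [hN1, ← mul_add] at h
      have := Nat.eq_of_mul_eq_mul_left hP1 h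
      omega
    · exact Or.inr (Or.inr h)
  have hIpos : ∀ a, 0 < #(S.filter fun x => bxor x a ∈ S) := fun a => by rcases hIval a with h | h | h <;> omega
  /- (2) divisibility `2·2^k ∣ w²` -/
  have hdvd : 2 * 2 ^ k ∣ #S * #S := by
    have h := kto_sq_dvd hr hgap c hc h2'
    rw [hN] at h
    exact Nat.dvd_of_mul_dvd_mul_left hP2 h
  /- (3) no periods: a period would let `c` descend to `k + r + 2` bits with weight `w/2` inside the smaller gap -/
  have hnoper : ∀ a, a ≠ zeroVec → #(S.filter fun x => bxor x a ∈ S) ≠ #S := by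
    intro a ha hIa
    have hsub : S.filter (fun x => bxor x a ∈ S) = S := eq_of_subset_of_card_le (filter_subset _ _) (by rw [hIa])
    have hinv : ∀ x, x ∈ S → bxor x a ∈ S := fun x hx => by
      have : x ∈ S.filter (fun x => bxor x a ∈ S) := by rw [hsub]; exact hx
      exact (mem_filter.1 this).2
    have hinv' : ∀ x, c (bxor x a) = c x := by
      intro x
      by_cases hx : x ∈ S
      · rw [(hmemS _).1 (hinv x hx), (hmemS _).1 hx]
      · have hxa : bxor x a ∉ S := fun h => hx (by simpa [iw_bxor_assoc] using hinv _ h)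
        have e1 : c x = false := by simpa [hmemS] using hx
        have e2 : c (bxor x a) = false := by simpa [hmemS] using hxa
        rw [e1, e2]
    obtain ⟨i₀, hi₀⟩ : ∃ i, a i = true := by
      by_contra h
      push Not at h
      exact ha (funext fun i => by simpa [zeroVec] using h i)
    -- restrict to the coordinate hyperplane `{x_{i₀} = 0}`
    set z : Fin (k + r + 2 + 1) → Bool := fun i => decide (i = i₀) with hz
    have hzi : z i₀ = true := by simp [hz]
    have hcoord : ∀ x : Fin (k + r + 2 + 1) → Bool, decide (Odd #(univ.filter fun i => (x i && z i) = true)) = x i₀ := by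
      intro x
      rw [ktg_card_and_split _ _ i₀, hzi, Bool.and_true]
      have h0 : #(univ.filter fun j : Fin (k + r + 2) => (x (i₀.succAbove j) && z (i₀.succAbove j)) = true) = 0 := by
        refine card_eq_zero.2 (filter_eq_empty_iff.2 fun j _ => ?_)
        simp [hz, Fin.succAbove_ne]
      rw [h0, add_zero]
      cases x i₀ <;> simp
    obtain ⟨c', hc', hcard'⟩ := ktg_restrict (k := k + r + 2) c hc z i₀ hzi false
    have hsym : #(univ.filter fun x => c x = true ∧ decide (Odd #(univ.filter fun i => (x i && z i) = true)) = true) =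
        #(univ.filter fun x => c x = true ∧ decide (Odd #(univ.filter fun i => (x i && z i) = true)) = false) := by
      simp_rw [hcoord]
      refine card_nbij' (fun x => bxor x a) (fun x => bxor x a) (fun x hx => ?_) (fun x hx => ?_)
        (fun x _ => by simp [iw_bxor_assoc]) (fun x _ => by simp [iw_bxor_assoc])
      · rw [mem_coe, mem_filter] at hx ⊢
        refine ⟨mem_univ _, by rw [hinv']; exact hx.2.1, ?_⟩
        show (x i₀ ^^ a i₀) = false
        rw [hx.2.2, hi₀]; rfl
      · rw [mem_coe, mem_filter] at hx ⊢
        refine ⟨mem_univ _, by rw [hinv']; exact hx.2.1, ?_⟩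
        show (x i₀ ^^ a i₀) = true
        rw [hx.2.2, hi₀]; rfl
    have hadd := ktg_half_add c z
    rw [hsym, ← hcard', ← hSdef] at hadd
    exact ih c' hc' ⟨by omega, by omega⟩
  /- (4) half weights along any hyperplane lie in six values -/
  have hQ : ∀ (e : (Fin (k + r + 2) → Bool) → Bool), IsDegLeFun (r + 1) e →
      #(univ.filter fun y => e y = true) = 0 ∨ #(univ.filter fun y => e y = true) = 2 * 2 ^ k ∨
        3 * 2 ^ k ≤ #(univ.filter fun y => e y = true) := by
    intro e he
    by_cases h0 : #(univ.filter fun y => e y = true) = 0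
    · exact Or.inl h0
    by_cases h3 : 3 * 2 ^ k ≤ #(univ.filter fun y => e y = true)
    · exact Or.inr (Or.inr h3)
    right; left
    have hne : ∃ y, e y = true := by
      by_contra hn
      push Not at hn
      exact h0 (card_eq_zero.2 (filter_eq_empty_iff.2 fun y _ => hn y))
    have hlt : 2 ^ (r + 1 + 1) * #(univ.filter fun y => e y = true) < 3 * 2 ^ (k + r + 2) := by
      rw [hNK3]; exact Nat.mul_lt_mul_of_pos_left (by omega) hP2
    have hsw := sw_second_weight_all (r + 1) (by omega) (k + r + 2) e he hne hlt
    rw [hNK] at hsw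
    exact Nat.eq_of_mul_eq_mul_left hP1 hsw
  have hhalf : ∀ z : Fin (k + r + 2 + 1) → Bool, z ≠ zeroVec →
      #(univ.filter fun x => c x = true ∧ decide (Odd #(univ.filter fun i => (x i && z i) = true)) = true) = 0 ∨
      #(univ.filter fun x => c x = true ∧ decide (Odd #(univ.filter fun i => (x i && z i) = true)) = true) = 2 * 2 ^ k ∨
      #(univ.filter fun x => c x = true ∧ decide (Odd #(univ.filter fun i => (x i && z i) = true)) = true) = 3 * 2 ^ k ∨
      #(univ.filter fun x => c x = true ∧ decide (Odd #(univ.filter fun i => (x i && z i) = true)) = true) + 3 * 2 ^ k = #S ∨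
      #(univ.filter fun x => c x = true ∧ decide (Odd #(univ.filter fun i => (x i && z i) = true)) = true) + 2 * 2 ^ k = #S ∨
      #(univ.filter fun x => c x = true ∧ decide (Odd #(univ.filter fun i => (x i && z i) = true)) = true) = #S := by
    intro z hz
    obtain ⟨i₀, hi₀⟩ : ∃ i, z i = true := by
      by_contra h
      push Not at h
      exact hz (funext fun i => by simpa [zeroVec] using h i)
    obtain ⟨cT, hcT, hcardT⟩ := ktg_restrict (k := k + r + 2) c hc z i₀ hi₀ true
    obtain ⟨cF, hcF, hcardF⟩ := ktg_restrict (k := k + r + 2) c hc z i₀ hi₀ false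
    have hadd := ktg_half_add c z
    rw [← hcardT, ← hcardF, ← hSdef] at hadd
    have hQT := hQ cT hcT
    have hQF := hQ cF hcF
    have hRT := ih cT hcT
    have hRF := ih cF hcF
    rw [← hcardT]
    omega
  /- (5) the character sum `F(z)`: `F(0) = w`, and `F(z)² ∈ {t², (2·2^k + t)²}` for `z ≠ 0` -/
  set F : (Fin (k + r + 2 + 1) → Bool) → ℝ := fun z => ∑ x ∈ S, twist x z with hFdef
  have hF0 : F zeroVec = #S := by
    simp only [F]
    rw [sum_congr rfl fun x _ => twist_zeroVec_right x, sum_const]; norm_num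
  have hFsq : ∀ z, z ≠ zeroVec → F z ^ 2 = ((t : ℕ) : ℝ) ^ 2 ∨ F z ^ 2 = ((2 * 2 ^ k + t : ℕ) : ℝ) ^ 2 := by
    intro z hz
    have hFz : F z = #S - 2 * (#(univ.filter fun x => c x = true ∧
        decide (Odd #(univ.filter fun i => (x i && z i) = true)) = true) : ℝ) := ktg_F_half c z
    obtain ⟨hne1, hne2⟩ := ktg_no_hyperplane S hIpos z hz
    change F z ≠ _ at hne1
    change F z ≠ _ at hne2
    have hw : ((#S : ℕ) : ℝ) = 6 * 2 ^ k + t := by rw [hwt]; push_cast; ring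
    rcases hhalf z hz with h | h | h | h | h | h
    · exfalso; apply hne1; rw [hFz, h]; norm_num
    · right; rw [hFz, h]; push_cast; rw [hw]; ring
    · left; rw [hFz, h]; push_cast; rw [hw]; ring
    · left
      have h' : (#(univ.filter fun x => c x = true ∧ decide (Odd #(univ.filter fun i => (x i && z i) = true)) = true) : ℝ) =
          #S - 3 * 2 ^ k := by
        rw [← h]; push_cast; ring
      rw [hFz, h', hw]; ring
    · right
      have h' : (#(univ.filter fun x => c x = true ∧ decide (Odd #(univ.filter fun i => (x i && z i) = true)) = true) : ℝ) =
          #S - 2 * 2 ^ k := by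
        rw [← h]; push_cast; ring
      rw [hFz, h', hw]; push_cast; ring
    · exfalso; apply hne2; rw [hFz, h]; ring
  have hαβ : ((t : ℕ) : ℝ) ^ 2 ≠ ((2 * 2 ^ k + t : ℕ) : ℝ) ^ 2 := by
    have h1' : ((t : ℕ) : ℝ) < ((2 * 2 ^ k + t : ℕ) : ℝ) := by
      have : t < 2 * 2 ^ k + t := by have := Nat.two_pow_pos k; omega
      exact_mod_cast this
    have h0 : (0 : ℝ) ≤ ((t : ℕ) : ℝ) := by positivity
    nlinarith
  obtain ⟨hPars, hAB⟩ := ktg_sum_two_values (fun z => F z ^ 2) zeroVec _ _ hαβ hFsq (fun x => x)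
  obtain ⟨hFour, -⟩ := ktg_sum_two_values (fun z => F z ^ 2) zeroVec _ _ hαβ hFsq (fun x => x ^ 2)
  set A := #(univ.filter fun z : Fin (k + r + 2 + 1) → Bool => z ≠ zeroVec ∧ F z ^ 2 = ((t : ℕ) : ℝ) ^ 2) with hAdef
  set B := #(univ.filter fun z : Fin (k + r + 2 + 1) → Bool => z ≠ zeroVec ∧ F z ^ 2 = ((2 * 2 ^ k + t : ℕ) : ℝ) ^ 2) with hBdef
  /- (6) the derivative intersections off `0`: `I(a) ∈ {t, 2·2^k + t}` -/
  set I : (Fin (k + r + 2 + 1) → Bool) → ℝ := fun a => (#(S.filter fun x => bxor x a ∈ S) : ℝ) with hIdef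
  have hI0 : I zeroVec = #S := by
    simp only [I]
    rw [filter_true_of_mem fun x hx => by rw [bxor_zeroVec]; exact hx]
  have hIval' : ∀ a, a ≠ zeroVec → I a = ((2 * 2 ^ k + t : ℕ) : ℝ) ∨ I a = ((t : ℕ) : ℝ) := by
    intro a ha
    rcases hIval a with h | h | h
    · right; simp only [I]; rw [h]
    · left; simp only [I]; rw [h]
    · exact absurd h (hnoper a ha)
  have hαβ' : ((2 * 2 ^ k + t : ℕ) : ℝ) ≠ ((t : ℕ) : ℝ) := by
    have : t < 2 * 2 ^ k + t := by have := Nat.two_pow_pos k; omega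
    have h1' : ((t : ℕ) : ℝ) < ((2 * 2 ^ k + t : ℕ) : ℝ) := by exact_mod_cast this
    exact h1'.ne'
  obtain ⟨hIsum, hn⟩ := ktg_sum_two_values I zeroVec _ _ hαβ' hIval' (fun x => x)
  obtain ⟨hIsq, -⟩ := ktg_sum_two_values I zeroVec _ _ hαβ' hIval' (fun x => x ^ 2)
  set n₁ := #(univ.filter fun a : Fin (k + r + 2 + 1) → Bool => a ≠ zeroVec ∧ I a = ((2 * 2 ^ k + t : ℕ) : ℝ)) with hn₁def
  set n₂ := #(univ.filter fun a : Fin (k + r + 2 + 1) → Bool => a ≠ zeroVec ∧ I a = ((t : ℕ) : ℝ)) with hn₂def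
  /- (7) the identities -/
  have hcardU : Fintype.card (Fin (k + r + 2 + 1) → Bool) = 2 ^ (k + r + 2 + 1) := by
    rw [Fintype.card_fun, Fintype.card_bool, Fintype.card_fin]
  have hNR : ((2 ^ (k + r + 2 + 1) : ℕ) : ℝ) = (2 : ℝ) ^ (k + r + 2 + 1) := by push_cast; ring
  have hParsEq : ∑ z, F z ^ 2 = (2 : ℝ) ^ (k + r + 2 + 1) * #S := ktg_parseval S
  have hFourEq : ∑ z, (F z ^ 2) ^ 2 = (2 : ℝ) ^ (k + r + 2 + 1) * ∑ a, I a ^ 2 := by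
    rw [show (∑ z, (F z ^ 2) ^ 2) = ∑ z, F z ^ 4 from sum_congr rfl fun z _ => by ring]
    exact ktg_fourth S
  have hIsumEq : ∑ a, I a = (#S : ℝ) * #S := by
    have h := ktg_sum_I S
    have h' : ((∑ a, #(S.filter fun x => bxor x a ∈ S) : ℕ) : ℝ) = ((#S * #S : ℕ) : ℝ) := by rw [h]
    push_cast at h'
    exact h'
  refine ⟨#S, t, A, B, n₁, n₂, rfl, hwt, hdvd, ?_, ?_, ?_, ?_, ?_⟩
  · rw [hcardU] at hAB; exact hAB
  · have e : (A : ℝ) * (t : ℝ) ^ 2 + (B : ℝ) * ((2 * 2 ^ k + t : ℕ) : ℝ) ^ 2 + (#S : ℝ) ^ 2 = ((2 ^ (k + r + 2 + 1) : ℕ) : ℝ) * #S := by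
      have h := hPars
      rw [hParsEq, hF0] at h
      rw [hNR]
      linear_combination (-1 : ℝ) * h
    exact_mod_cast e
  · rw [hcardU] at hn; exact hn
  · have e : (n₁ : ℝ) * ((2 * 2 ^ k + t : ℕ) : ℝ) + (n₂ : ℝ) * (t : ℝ) + (#S : ℝ) = (#S : ℝ) ^ 2 := by
      have h := hIsum
      rw [hIsumEq, hI0] at h
      linear_combination (-1 : ℝ) * h
    exact_mod_cast e
  · have e : (#S : ℝ) ^ 4 + (A : ℝ) * (t : ℝ) ^ 4 + (B : ℝ) * ((2 * 2 ^ k + t : ℕ) : ℝ) ^ 4 =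
        ((2 ^ (k + r + 2 + 1) : ℕ) : ℝ) * ((#S : ℝ) ^ 2 + (n₁ : ℝ) * ((2 * 2 ^ k + t : ℕ) : ℝ) ^ 2 + (n₂ : ℝ) * (t : ℝ) ^ 2) := by
      have h4 := hFour
      have hI2 := hIsq
      rw [hFourEq, hF0] at h4
      rw [hI0] at hI2
      rw [hI2] at h4
      rw [hNR]
      linear_combination (-1 : ℝ) * h4
    exact_mod_cast e

end Summit.QuantumAdvantage.QuantumAdvantage.Theorems.CubicForrelation.NearExactIsExact

end
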